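import Summits.BirchSwinnertonDyer.BirchSwinnertonDyer.Theorems.ByReductionTypeAtTwoFineSelmerConjAAtTwoAdditivePotGoodCoinvariantGenusCertificate28712LayerOne
import Literature.NumberTheory.IwasawaTheory.NarrowFukudaCertificateLayerTwoModel
import Literature.NumberTheory.IwasawaTheory.CyclotomicTwoTotallyRamifiedOddIndex
import Literature.NumberTheory.IwasawaTheory.ZpExtensionNormKernelLayerPair
import Literature.NumberTheory.NumberFields.QuadraticExtensionOddClassNumberNonNormUnit
import HarnessLib

/-!
# Route `ByReductionTypeAtTwo` (rung K4), crux C1″ `FineSelmerConjAAtTwoAdditivePotGood` (item stmt-BirchSwinnertonDyer-22615, cc C3″ 22617):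
# THE CENSUS ROW `315832c1` — THE `r = 1` INPUT OF THE COINVARIANT-GENUS ROAD ON THE ABSTRACT LAYERS `K₁ ⊂ K₂` OF EVERY CYCLOTOMIC
# `ℤ₂`-EXTENSION OF THE CUBIC POINT FIELD `ℚ(θ)` (`θ³ − θ² − 24θ + 88 = 0`, `d = −28712`): a unit of `K₁` that is NOT a norm from `K₂`, in the
# `hu / hnot` currency of `AddKatoTwo.two_dvd_relIndex_of_nonNorm` (KERNEL; a `--supports 22615` file; seat `bsd-2adic-k4-w1` GEN 12; sequel of
# `…CoinvariantGenusCertificate28712LayerOne`)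

HONEST FRAMING (cell `bsd-2adic`, D-0036/D-0054/D-0152): KERNEL theorems; no elliptic curve, no named fact, no `sorry`, no definition.  Closes nothing at
the `∀`-level (C1″ 22615 research-open); nothing booked; BSD for `315832c1` is NOT proved by this.  It discharges the ONE displayed hypothesis of k4-w2
GEN 14's row stamp `conjA_two_315832c1_of_layerOneNonNormUnit` (the unit-norm index `[E_{K₁} : E_{K₁} ∩ N K₂ˣ]` is even), for EVERY cyclotomic
`ℤ₂`-extension `κ` of `ℚ(θ)` and EVERY compatible algebra structure `K₁ → K₂`.

THE ARGUMENT.  `[ℚ(θ):ℚ] = 3` is odd, so `K₁ = κ.layer 1 ∋ s` with `s² = 2` (tree `exists_sq_eq_two_layer_one_of_not_dvd_finrank`) and `K₂ = κ.layer 2 ∋ e`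
with `e⁴ − 4e² + 2 = 0` (tree `exists_quartic_root_layer_two_of_not_dvd_finrank`), `[K₁ : ℚ(θ)] = 2`, `[K₂ : K₁] = 2` (`finrank_layer_holds`,
`finrank_layer_layer`).  In `K₂`, `(e² − 2)² = 2 = s²` forces `e² = 2 ± s`, and `e ∉ K₁` (`[ℚ(θ)(e) : ℚ(θ)] = 4 ∤ 2`).  The MODEL-FREE sextic theorem
`exists_unit_forall_sq_sub_mul_sq_ne_d28712` (previous file) at `F = K₁` with the square root `±s` gives a unit `η ∈ 𝓞 K₁` with `a² − (2 ± s)c² ≠ η`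
for all `a, c ∈ K₁`; O'Meara 63:10 in the tree's Chevalley currency (`AmbiguousClass.not_mem_map_norm_of_forall_sq_sub_mul_sq_ne`) turns this into
`η ∉ N_{Gal(K₂/K₁)} K₂ˣ`.

* `exists_unitsIncl_not_mem_norm_of_forall_sq_sub_mul_sq_ne` — generic packaging: `L = M(e)`, `e² = m`, `e ∉ M`, `[L:M] = 2`, a unit `η` of `𝓞 M` with
  `a² − m c² ≠ η` ⟹ `∃ u ∈ E_M ⊆ Lˣ`, `u ∉ N_G Lˣ` (the `hu`/`hnot` pair).
* ★ `exists_nonNorm_unit_layers_d28712` — the pair for `(κ.layer 1, κ.layer 2)`, every cyclotomic `κ` over `ℚ(θ)`, any compatible algebra structure.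

References: [Omeara1963] §63B (63:10); [Washington1997] §13.1 (`K_n = K·ℚ_n`, `ℚ_1 = ℚ(√2)`, `ℚ_2 = ℚ(ζ₁₆)⁺`), §13.3 Prop. 13.22–13.23; [Gras2003] IV.4;
[Lang1990] Ch. 13 §4 Lemma 4.1–4.2.
-/

set_option autoImplicit false
-- sibling precedent: the directory name repeats the summit name
set_option linter.dupNamespace false

noncomputable section

open scoped Classical IntermediateField NumberField nonZeroDivisors

namespace Summit.BirchSwinnertonDyer.BirchSwinnertonDyer.Theorems.AddKatoTwo

open Polynomial IsDedekindDomain NumberField Field IntermediateField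
  Literature.NumberTheory.EllipticCurves Literature.NumberTheory.EllipticCurves.ZpExtension
  Literature.NumberTheory.IwasawaTheory Literature.NumberTheory.NumberFields Literature.NumberTheory.NumberFields.AmbiguousClass
  Literature.NumberTheory.GaloisRepresentations Literature.NumberTheory.GaloisRepresentations.Herbrand
  Literature.NumberTheory.GaloisRepresentations.MinkowskiUnit Literature.NumberTheory.GaloisRepresentations.CyclicNormIndex

/-! ## §1 Generic packaging: a non-norm unit in Chevalley's currency -/

/-- **From the norm form to Chevalley's currency.** `L/M` Galois of degree `2`, `e ∈ L` with `e² = m ∈ M` and `e ∉ M`, and a unit `η` of `𝓞 M`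
with `a² − m c² ≠ η` for all `a, c ∈ M`: then `u = η ∈ Lˣ` lies in `E_M = 𝓞_Lˣ ∩ Mˣ` and NOT in `N_{Gal(L/M)} Lˣ` — the `hu`/`hnot` pair of
`AddKatoTwo.two_dvd_relIndex_of_nonNorm`. (O'Meara 63:10: every element of `L = M(e)` is `a + ce` with norm `a² − m c²`.)
[cite: Omeara1963, §63B (63:10)] [cite: Lang1990, Ch. 13 §4, Lemma 4.1–4.2 (PDF pp. 203–204)] -/
theorem exists_unitsIncl_not_mem_norm_of_forall_sq_sub_mul_sq_ne {M L : Type} [Field M] [NumberField M] [Field L] [NumberField L]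
    [Algebra M L] [IsGalois M L] (h2 : Module.finrank M L = 2) {e : L} {m : M} (he : e ^ 2 = algebraMap M L m)
    (heM : e ∉ Set.range (algebraMap M L)) (η : (𝓞 M)ˣ) (hne : ∀ a c : M, a ^ 2 - m * c ^ 2 ≠ ((η : 𝓞 M) : M)) :
    ∃ u : Lˣ, u ∈ unitsE L ⊓ (unitsIncl M L).range ∧ u ∉ unitsE L ⊓ (⊤ : Subgroup Lˣ).map (Herbrand.norm (L ≃ₐ[M] L)) := by
  set u : Mˣ := Units.map (algebraMap (𝓞 M) M : 𝓞 M →* M) η with hu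
  have huval : (u : M) = ((η : 𝓞 M) : M) := rfl
  have hxE : unitsIncl M L u ∈ unitsE L ⊓ (unitsIncl M L).range := by
    refine ⟨mem_unitsE_iff.mpr ⟨Units.map (algebraMap (𝓞 M) (𝓞 L) : 𝓞 M →* 𝓞 L) η, Units.ext ?_⟩, ⟨u, rfl⟩⟩
    simp only [Units.coe_map, MonoidHom.coe_coe, huval]
    exact (IsScalarTower.algebraMap_apply (𝓞 M) (𝓞 L) L _).symm.trans (IsScalarTower.algebraMap_apply (𝓞 M) M L _)
  have hxN := not_mem_map_norm_of_forall_sq_sub_mul_sq_ne h2 he heM u (by rw [huval]; exact hne)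
  exact ⟨unitsIncl M L u, hxE, fun h => hxN h.2⟩

/-! ## §2 The layers `K₁ ⊂ K₂` over `ℚ(θ)`, `θ³ − θ² − 24θ + 88 = 0` -/

set_option maxHeartbeats 800000 in
/-- ★ **A unit of `K₁` outside `N_{Gal(K₂/K₁)} K₂ˣ` for the cubic point field of `315832c1`** (`K` any cubic number field containing a root `θ` of
`X³ − X² − 24X + 88`, `d = −28712`): for every cyclotomic `ℤ₂`-extension `κ` of `K` and every algebra structure `κ.layer 1 → κ.layer 2` compatible with
`K`, there is `u ∈ (κ.layer 2)ˣ` in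
`E_{K₁} = 𝓞ˣ ∩ K₁ˣ` and not in `N_G (κ.layer 2)ˣ` — so `2 ∣ [E_{K₁} : E_{K₁} ∩ N K₂ˣ]` (`two_dvd_relIndex_of_nonNorm`), the `r = 1` of the genus road
`rank₂ Cl(K₁) + t ≤ 2 + r`.  KERNEL: `K₁ ∋ √2`, `K₂ ∋ √(2 ± √2)` of degree `2` over `K₁`, and the model-free sextic certificate
`exists_unit_forall_sq_sub_mul_sq_ne_d28712` (unit `η′ ≡` non-norm at the dyadic prime `(ξ)`, `e = 2`, `f = 1`). BSD for `315832c1` is NOT proved by this.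
[cite: Washington1997, §13.1 and §13.3 Prop. 13.22–13.23] [cite: Omeara1963, §63B (63:10)] [cite: Gras2003, IV.4] -/
theorem exists_nonNorm_unit_layers_d28712 (K : Type) [Field K] [NumberField K] (h3 : Module.finrank ℚ K = 3) (b : 𝓞 K)
    (hb : b ^ 3 + (-1 : ℤ) * b ^ 2 + (-24 : ℤ) * b + (88 : ℤ) = 0) (κ : ZpExtension K 2) (hκ : κ.IsCyclotomic)
    [NumberField (κ.layer 1)] [NumberField (κ.layer 2)] [Algebra (κ.layer 1) (κ.layer 2)] [IsScalarTower K (κ.layer 1) (κ.layer 2)] :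
    ∃ u : (κ.layer 2)ˣ, u ∈ unitsE (κ.layer 2) ⊓ (unitsIncl (κ.layer 1) (κ.layer 2)).range ∧
      u ∉ unitsE (κ.layer 2) ⊓ (⊤ : Subgroup (κ.layer 2)ˣ).map (Herbrand.norm ((κ.layer 2) ≃ₐ[κ.layer 1] (κ.layer 2))) := by
  have hodd : Odd (Module.finrank ℚ K) := by rw [h3]; decide
  have hnd : ¬ 2 ∣ Module.finrank ℚ K := by rw [h3]; norm_num
  haveI : FiniteDimensional K (κ.layer 1) := κ.finiteDimensional_layer_holds 1
  haveI : FiniteDimensional K (κ.layer 2) := κ.finiteDimensional_layer_holds 2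
  haveI : FiniteDimensional (κ.layer 1) (κ.layer 2) := Module.Finite.of_restrictScalars_finite K (κ.layer 1) (κ.layer 2)
  haveI : IsGalois (κ.layer 1) (κ.layer 2) := isGalois_layer_layer κ
  have h2M : Module.finrank K (κ.layer 1) = 2 := by rw [κ.finrank_layer_holds 1]; norm_num
  have h2L : Module.finrank (κ.layer 1) (κ.layer 2) = 2 := by rw [finrank_layer_layer κ (by norm_num : 1 ≤ 2)]; norm_num
  -- `s ∈ K₁`, `s² = 2`; `e ∈ K₂`, `e⁴ − 4e² + 2 = 0`
  obtain ⟨s, hs⟩ := exists_sq_eq_two_layer_one_of_not_dvd_finrank hnd κ hκ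
  obtain ⟨e, he⟩ := exists_quartic_root_layer_two_of_not_dvd_finrank hnd κ hκ
  -- `e ∉ K₁`
  have heM : e ∉ Set.range (algebraMap (κ.layer 1) (κ.layer 2)) := by
    rintro ⟨y, hy⟩
    have hy4 : y ^ 4 - 4 * y ^ 2 + 2 = 0 := by
      apply (algebraMap (κ.layer 1) (κ.layer 2)).injective
      rw [map_add, map_sub, map_mul, map_pow, map_pow, map_ofNat, map_ofNat, map_zero, hy]
      exact he
    have h4 := finrank_adjoin_quartic_root hodd y hy4
    have htower := Module.finrank_mul_finrank K ↥K⟮y⟯ (κ.layer 1)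
    rw [h4, h2M] at htower
    omega
  -- `e² = 2 + s` or `e² = 2 − s`
  have hprod : (e ^ 2 - algebraMap (κ.layer 1) (κ.layer 2) (2 + s)) * (e ^ 2 - algebraMap (κ.layer 1) (κ.layer 2) (2 - s)) = 0 := by
    have hs' : (algebraMap (κ.layer 1) (κ.layer 2) s) ^ 2 = 2 := by rw [← map_pow, hs, map_ofNat]
    rw [map_add, map_sub, map_ofNat]
    linear_combination he - hs'
  rcases mul_eq_zero.mp hprod with h1 | h1
  · obtain ⟨η, hne⟩ := exists_unit_forall_sq_sub_mul_sq_ne_d28712 K (κ.layer 1) h3 h2M b hb s hs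
    exact exists_unitsIncl_not_mem_norm_of_forall_sq_sub_mul_sq_ne h2L (sub_eq_zero.mp h1) heM η hne
  · have hs' : (-s) ^ 2 = 2 := by rw [neg_sq]; exact hs
    obtain ⟨η, hne⟩ := exists_unit_forall_sq_sub_mul_sq_ne_d28712 K (κ.layer 1) h3 h2M b hb (-s) hs'
    refine exists_unitsIncl_not_mem_norm_of_forall_sq_sub_mul_sq_ne h2L (m := 2 + -s) ?_ heM η hne
    rw [← sub_eq_add_neg]; exact sub_eq_zero.mp h1

end Summit.BirchSwinnertonDyer.BirchSwinnertonDyer.Theorems.AddKatoTwo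

end
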